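import Summits.QuantumFields.YangMills.Theorems.LocalInsertionHistoryTailOfInsertionLPerPlaquette
import HarnessLib

/-!
# Line «local_insertion» on crux `HistoryTailL` (stmt-QuantumFields-19936) — CHERNOFF AT EVERY LEVEL BELOW THE THRESHOLD, AND THE MEDIAN
# FROM THE INSERTION BOUND (converse half of «insertion ⟺ window tail below the cap»; «insertion ⇒ median at scale g»)

Cell `ym3-torus` (YM ladder rung R3 = continuum SU(2) Yang–Mills on the three-torus — a RUNG, NOT the Clay problem: not d = 4, not
infinite volume, not a mass gap), width seat `ym-ust-19936-w3` gen 11, `--supports stmt-QuantumFields-19936 --as helper`.  THEOREMS ONLY,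
definition-free, ROUTE-INDEPENDENT (no `Theses` import; the objects are spelled out).  HONEST FRAMING: pure Chernoff/Markov bookkeeping at one
instance `(F, γ, K, j, a)` and an ARBITRARY measurable event `G` (same generality as the cross-cell ✓`HistoryTailOfInsertion.chernoff_local`, which
is the level `t = p(g)` of §1).  Nothing of `LocalInsertionL` (stmt-23607), the glue 23608, the stubs of `Cruxes/HistoryTailL/Lines/local_insertion.lean`,
the crux `HistoryTailL` or any summit statement is proved.

* §1 ★`chernoff_level`: if `∫_G exp(ε·min(dist1(Ū^j(∂a))/g, p(g))) ∂Gibbs_K ≤ M₀` (`g = g_{K−j}`, `ε > 0`) then for EVERY level `t` with `t·g ≤ θ(K−j)`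
  (i.e. `t ≤ p(g)`, below Bałaban's threshold): `Gibbs_K(G ∩ {t·g ≤ dist1(Ū^j(∂a))}) ≤ M₀·e^{−εt}`; `windowExpTailBelowCap_of_insertion`: the same at
  the integer levels `n : ℕ` — the converse of ✓`MomentOfWindowTail.insertionIntegral_le_of_expTail` BELOW THE CAP (above the cap, up to `2/g`, the
  insertion bound says nothing).
* §2 ★★`median_of_insertion`: the insertion bound at `ε`, local goodness `Gibbs_K(Gᶜ) ≤ ¼` and a level `m` with `log(4M₀)/ε ≤ m`, `m·g ≤ θ(K−j)` give
  the MEDIAN ROW `½ ≤ Gibbs_K(G ∩ {dist1(Ū^j(∂a)) ≤ m·g})` consumed by ✓`WindowTailOfConcentration.windowTail_step`.  READING (with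
  ✓`InsertionStepOfConcentration.insertion_step`): given K1 ∧ K2 ∧ `Gibbs_K(G(a,j)ᶜ) ≤ ¼`, at interior heights the LocalInsertionL integrand bound
  and the median of the block flux AT SCALE `g_{K−j}` are EQUIVALENT (K-uniformly, constants explicit) — the content of line #13 beyond line #12's
  cruxes is exactly the median row.
[cite: Balaban1985UV3, (7) p.257 and (71) p.273]
-/

set_option autoImplicit false

noncomputable section

open scoped BigOperators
open MeasureTheory Set
open Literature.MathematicalPhysics.QuantumFieldTheory.Balaban1983to89
open Literature.MathematicalPhysics.QuantumFieldTheory.Balaban1983to89.T3ContinuumYM3Torus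
open Literature.MathematicalPhysics.QuantumFieldTheory.Balaban1983to89.T3UnitScaleTilt
open Literature.MathematicalPhysics.QuantumFieldTheory.Balaban1983to89.T3UnitLawDensityEML
open Summit.QuantumFields.YangMills.Theorems.LocalInsertion.HistoryTailOfInsertion (measurable_flux)

namespace Summit.QuantumFields.YangMills.Theorems.LocalInsertion.MedianOfInsertion

/-! ## §1 Chernoff at every level below the threshold -/

/-- **CHERNOFF AT LEVEL `t ≤ p(g)`.**  If the Gibbs integral over `G` of `exp(ε·min(dist1(Ū^j(∂a))/g, p(g)))` (`g = g_{K−j}`, `ε > 0`) is `≤ M₀`,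
then for every real level `t` with `t·g ≤ θ(K−j) = g·p(g)`: `Gibbs_K(G ∩ {t·g ≤ dist1(Ū^j(∂a))}) ≤ M₀·e^{−εt}` (on that event the capped
normalised flux is `≥ t`).  The level `t = p(g)` is ✓`chernoff_local`. [cite: Balaban1985UV3, (7) p.257 and (71) p.273] -/
theorem chernoff_level (F : T3Family) {γ b₀ p₀ ε M₀ : ℝ} (hγ : 0 < γ) (hε : 0 < ε) {K j : ℕ} (a : Plaq (F.P K) j)
    {G : Set (GaugeField (F.P K) 0 (Matrix.specialUnitaryGroup (Fin 2) ℂ))} (hG : MeasurableSet G)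
    (hint : ∫ U in G, Real.exp (ε * min (GaugeGroup.dist1 (GaugeField.plaqHol (Averaging.iter (fun i' => BlockAveraging.blockAvg (P := F.P K) (j := i') ℰp) j U) a) / Real.sqrt (γ * ((F.L : ℝ)⁻¹) ^ (K - j))) (B10.pFun b₀ p₀ (Real.sqrt (γ * ((F.L : ℝ)⁻¹) ^ (K - j))))) ∂(gibbsK F ℰp γ K) ≤ M₀)
    (t : ℝ) (ht : t * Real.sqrt (γ * ((F.L : ℝ)⁻¹) ^ (K - j)) ≤ θBal F.L γ b₀ p₀ (K - j)) :
    (gibbsK F ℰp γ K).real (G ∩ {U | t * Real.sqrt (γ * ((F.L : ℝ)⁻¹) ^ (K - j)) ≤ GaugeGroup.dist1 (GaugeField.plaqHol (Averaging.iter (fun i' => BlockAveraging.blockAvg (P := F.P K) (j := i') ℰp) j U) a)}) ≤ M₀ * Real.exp (-(ε * t)) := by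
  haveI := isProbabilityMeasure_gibbsK F ℰp hγ.le K
  set μ := gibbsK F ℰp γ K with hμ
  set gK : ℝ := Real.sqrt (γ * ((F.L : ℝ)⁻¹) ^ (K - j)) with hgK
  set P : ℝ := B10.pFun b₀ p₀ gK with hP
  set f : GaugeField (F.P K) 0 (Matrix.specialUnitaryGroup (Fin 2) ℂ) → ℝ := fun U => GaugeGroup.dist1 (GaugeField.plaqHol (Averaging.iter (fun i' => BlockAveraging.blockAvg (P := F.P K) (j := i') ℰp) j U) a) with hf
  have hfm : Measurable f := measurable_flux F K j a
  have hgpos : 0 < gK :=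
    Real.sqrt_pos.2 (mul_pos hγ (pow_pos (inv_pos.2 (by exact_mod_cast lt_trans zero_lt_one F.hL.2)) _))
  have hθ : θBal F.L γ b₀ p₀ (K - j) = gK * P := rfl
  have htP : t ≤ P := by
    rw [hθ, mul_comm gK P] at ht
    exact le_of_mul_le_mul_right ht hgpos
  set φ : GaugeField (F.P K) 0 (Matrix.specialUnitaryGroup (Fin 2) ℂ) → ℝ := fun U => Real.exp (ε * min (f U / gK) P) with hφ
  have hφm : Measurable φ := Real.measurable_exp.comp (measurable_const.mul ((hfm.div_const gK).min measurable_const))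
  have hφle : ∀ U, φ U ≤ Real.exp (ε * P) := fun U =>
    Real.exp_le_exp.2 (mul_le_mul_of_nonneg_left (min_le_right _ _) hε.le)
  have hφ0 : ∀ U, 0 ≤ φ U := fun U => Real.exp_nonneg _
  have hφint : Integrable φ μ :=
    (integrable_const (Real.exp (ε * P))).mono' hφm.aestronglyMeasurable
      (Filter.Eventually.of_forall fun U => by rw [Real.norm_eq_abs, abs_of_nonneg (hφ0 U)]; exact hφle U)
  set B : Set (GaugeField (F.P K) 0 (Matrix.specialUnitaryGroup (Fin 2) ℂ)) := {U | t * gK ≤ f U} with hB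
  have hBm : MeasurableSet B := measurableSet_le measurable_const hfm
  have hφB : ∀ U ∈ G ∩ B, Real.exp (ε * t) ≤ φ U := by
    intro U hU
    have hU1 : t * gK ≤ f U := hU.2
    have h1 : t ≤ f U / gK := by rw [le_div_iff₀ hgpos]; exact hU1
    have hmin : t ≤ min (f U / gK) P := le_min h1 htP
    exact Real.exp_le_exp.2 (mul_le_mul_of_nonneg_left hmin hε.le)
  have h1 : Real.exp (ε * t) * μ.real (G ∩ B) ≤ ∫ U in G ∩ B, φ U ∂μ := by
    have := setIntegral_ge_of_const_le (hG.inter hBm) (measure_ne_top μ _) hφB hφint.integrableOn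
    simpa [Measure.real, mul_comm] using this
  have h2 : ∫ U in G ∩ B, φ U ∂μ ≤ ∫ U in G, φ U ∂μ :=
    setIntegral_mono_set hφint.integrableOn (Filter.Eventually.of_forall fun U => hφ0 U)
      (Filter.Eventually.of_forall Set.inter_subset_left)
  have h3 : ∫ U in G, φ U ∂μ ≤ M₀ := hint
  have hexp : 0 < Real.exp (ε * t) := Real.exp_pos _
  calc μ.real (G ∩ B) = (Real.exp (ε * t) * μ.real (G ∩ B)) * Real.exp (-(ε * t)) := by
        rw [Real.exp_neg]; field_simp
    _ ≤ M₀ * Real.exp (-(ε * t)) :=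
        mul_le_mul_of_nonneg_right (h1.trans (h2.trans h3)) (Real.exp_nonneg _)

/-- **THE WINDOW TAIL BELOW THE CAP FROM THE INSERTION BOUND** (integer levels): `Gibbs_K(G ∩ {n·g ≤ dist1(Ū^j(∂a))}) ≤ M₀·e^{−εn}` for every
`n : ℕ` with `n·g ≤ θ(K−j)` — the converse of ✓`MomentOfWindowTail.insertionIntegral_le_of_expTail` below the threshold.
[cite: Balaban1985UV3, (7) p.257 and (71) p.273] -/
theorem windowExpTailBelowCap_of_insertion (F : T3Family) {γ b₀ p₀ ε M₀ : ℝ} (hγ : 0 < γ) (hε : 0 < ε) {K j : ℕ} (a : Plaq (F.P K) j)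
    {G : Set (GaugeField (F.P K) 0 (Matrix.specialUnitaryGroup (Fin 2) ℂ))} (hG : MeasurableSet G)
    (hint : ∫ U in G, Real.exp (ε * min (GaugeGroup.dist1 (GaugeField.plaqHol (Averaging.iter (fun i' => BlockAveraging.blockAvg (P := F.P K) (j := i') ℰp) j U) a) / Real.sqrt (γ * ((F.L : ℝ)⁻¹) ^ (K - j))) (B10.pFun b₀ p₀ (Real.sqrt (γ * ((F.L : ℝ)⁻¹) ^ (K - j))))) ∂(gibbsK F ℰp γ K) ≤ M₀)
    (n : ℕ) (hn : (n : ℝ) * Real.sqrt (γ * ((F.L : ℝ)⁻¹) ^ (K - j)) ≤ θBal F.L γ b₀ p₀ (K - j)) :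
    (gibbsK F ℰp γ K).real (G ∩ {U | (n : ℝ) * Real.sqrt (γ * ((F.L : ℝ)⁻¹) ^ (K - j)) ≤ GaugeGroup.dist1 (GaugeField.plaqHol (Averaging.iter (fun i' => BlockAveraging.blockAvg (P := F.P K) (j := i') ℰp) j U) a)}) ≤ M₀ * Real.exp (-(ε * n)) :=
  chernoff_level F hγ hε a hG hint (n : ℝ) hn

/-! ## §2 The median row from the insertion bound -/

/-- **INSERTION BOUND ⇒ MEDIAN AT SCALE `g`.**  If `∫_G exp(ε·min(dist1(Ū^j(∂a))/g, p(g))) ∂Gibbs_K ≤ M₀` (`ε > 0`), `Gibbs_K(Gᶜ) ≤ ¼`, and the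
level `m` satisfies `log(4M₀)/ε ≤ m` and `m·g ≤ θ(K−j)`, then `½ ≤ Gibbs_K(G ∩ {dist1(Ū^j(∂a)) ≤ m·g})` — the hypothesis `hMed` of
✓`WindowTailOfConcentration.windowTail_step` (Chernoff at level `m`: the upper part of `G` has mass `≤ M₀e^{−εm} ≤ ¼`).
[cite: Balaban1985UV3, (7) p.257 and (71) p.273] -/
theorem median_of_insertion (F : T3Family) {γ b₀ p₀ ε M₀ m : ℝ} (hγ : 0 < γ) (hε : 0 < ε) {K j : ℕ} (a : Plaq (F.P K) j)
    {G : Set (GaugeField (F.P K) 0 (Matrix.specialUnitaryGroup (Fin 2) ℂ))} (hG : MeasurableSet G)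
    (hint : ∫ U in G, Real.exp (ε * min (GaugeGroup.dist1 (GaugeField.plaqHol (Averaging.iter (fun i' => BlockAveraging.blockAvg (P := F.P K) (j := i') ℰp) j U) a) / Real.sqrt (γ * ((F.L : ℝ)⁻¹) ^ (K - j))) (B10.pFun b₀ p₀ (Real.sqrt (γ * ((F.L : ℝ)⁻¹) ^ (K - j))))) ∂(gibbsK F ℰp γ K) ≤ M₀)
    (hGc : (gibbsK F ℰp γ K).real Gᶜ ≤ 1 / 4) (hm : Real.log (4 * M₀) / ε ≤ m) (hmθ : m * Real.sqrt (γ * ((F.L : ℝ)⁻¹) ^ (K - j)) ≤ θBal F.L γ b₀ p₀ (K - j)) :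
    1 / 2 ≤ (gibbsK F ℰp γ K).real (G ∩ {U | GaugeGroup.dist1 (GaugeField.plaqHol (Averaging.iter (fun i' => BlockAveraging.blockAvg (P := F.P K) (j := i') ℰp) j U) a) ≤ m * Real.sqrt (γ * ((F.L : ℝ)⁻¹) ^ (K - j))}) := by
  haveI := isProbabilityMeasure_gibbsK F ℰp hγ.le K
  set μ := gibbsK F ℰp γ K with hμ
  set gK : ℝ := Real.sqrt (γ * ((F.L : ℝ)⁻¹) ^ (K - j)) with hgK
  set f : GaugeField (F.P K) 0 (Matrix.specialUnitaryGroup (Fin 2) ℂ) → ℝ := fun U => GaugeGroup.dist1 (GaugeField.plaqHol (Averaging.iter (fun i' => BlockAveraging.blockAvg (P := F.P K) (j := i') ℰp) j U) a) with hf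
  -- the upper part of `G` at level `m`
  have hup : μ.real (G ∩ {U | m * gK ≤ f U}) ≤ 1 / 4 := by
    have h := chernoff_level F hγ hε a hG hint m hmθ
    refine h.trans ?_
    by_cases hM : M₀ ≤ 0
    · have : M₀ * Real.exp (-(ε * m)) ≤ 0 := mul_nonpos_of_nonpos_of_nonneg hM (Real.exp_nonneg _)
      linarith
    · push Not at hM
      have h4 : 0 < 4 * M₀ := by linarith
      have hεm : Real.log (4 * M₀) ≤ ε * m := by rwa [div_le_iff₀' hε] at hm
      calc M₀ * Real.exp (-(ε * m)) ≤ M₀ * Real.exp (-Real.log (4 * M₀)) :=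
            mul_le_mul_of_nonneg_left (Real.exp_le_exp.2 (by linarith)) hM.le
        _ = 1 / 4 := by rw [Real.exp_neg, Real.exp_log h4]; field_simp
  -- `G ⊆ (G ∩ {f ≤ m g}) ∪ (G ∩ {m g ≤ f})`
  have hcover : G ⊆ (G ∩ {U | f U ≤ m * gK}) ∪ (G ∩ {U | m * gK ≤ f U}) := by
    intro U hU
    by_cases h : f U ≤ m * gK
    · exact Or.inl ⟨hU, h⟩
    · exact Or.inr ⟨hU, (not_le.mp h).le⟩
  have hGge : 3 / 4 ≤ μ.real G := by
    have h1 : μ.real G + μ.real Gᶜ = 1 := probReal_add_probReal_compl hG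
    linarith
  have hsplit : μ.real G ≤ μ.real (G ∩ {U | f U ≤ m * gK}) + μ.real (G ∩ {U | m * gK ≤ f U}) :=
    (measureReal_mono hcover (measure_ne_top _ _)).trans (measureReal_union_le _ _)
  have : 1 / 2 ≤ μ.real (G ∩ {U | f U ≤ m * gK}) := by linarith
  simpa only [hμ, hf, hgK] using this

end Summit.QuantumFields.YangMills.Theorems.LocalInsertion.MedianOfInsertion
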